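import Summits.AtomisticToContinuum.FouriersLaw.Theorems.BondHeatUncertaintyBoundedResponseBathHeatParity
import Summits.AtomisticToContinuum.FouriersLaw.Theorems.BondHeatUncertaintyBoundedResponseTransientBand
import Summits.AtomisticToContinuum.FouriersLaw.Theorems.PhononMeanFreePathIncoherentChannelLightConeHelper2
import HarnessLib

/-!
(SPLIT FOR THE 400-LINE CAP by the landing lane, hand-2 g39: this file = part 1 of 5; sequels `…BondHeatUncertaintyBoundedResponseBathHeatCumulantB`, `…BondHeatUncertaintyBoundedResponseBathHeatCumulantC`, `…BondHeatUncertaintyBoundedResponseBathHeatCumulantD`, `…BondHeatUncertaintyBoundedResponseBathHeatCumulant` import it in a chain; same namespace, all FQNs unchanged.)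
# BondHeatUncertainty / BoundedResponse — «BathHeat» §8–§10: the WICK DEFECT of the boundary kinetic kernel, its two channels, and forecastability
(decomp-a2c lens-1 «grading / quantitative ladder», g108, NODE 108 «CumulantChannels»; blocker item stmt-AtomisticToContinuum-11071 = `BoundedResponse`)

THE QUESTION OF RECORD (critic row 1474 (A), POINTERS-g108 item 0).  The (S)-side door beneath the blocker is
`11071 ⟸ (S) ∧ (BKᶠ_{0,3/2})` (`boundedResponse_of_subdiffusiveBondHeat_bathKernelFloor`), (BKᶠ) ⟺ (PDᶠ) (`bathKernelFloor_iff_bathParityDominance`):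
an `N`-uniform ONE-SIDED floor `K_N(r) ≥ −A r^{−3/2}` on the boundary kinetic autocovariance `K_N(r) = Cov_{μ_T}(p₀(0)², p₀(r)²)`.  For PHONONS it
holds with `A = 0` because `K_N = 2·Cov(p₀(0),p₀(r))²` is TWICE THE SQUARE OF A LINEAR FUNCTIONAL (Isserlis/Wick).  «What replaces the square of a
linear functional anharmonically?»

ANSWER TYPED HERE (§8).  Nothing replaces it — it is SUBTRACTED, exactly, for every chain: with the boundary MOMENTUM autocovariance
`c_N(r) := ⟨p₀, P_r p₀⟩_{μ_T}` (`bathMomCorr`; `T ×` the velocity response of the bath particle to a kick on itself; the same-site member of the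
coherent response field `momResp` of the dormant route `PhononMeanFreePath`) one has the WICK SPLIT
  `K_N(r) = 2·c_N(r)² + κ_N(r)`,  `κ_N(r) := K_N(r) − 2c_N(r)²` (`bathCumulant`) = the joint fourth CUMULANT `cum₄(p₀(0),p₀(0),p₀(r),p₀(r))` of the
stationary two-time law of the boundary momentum (both marginals are `N(0,T)`; the PAIR is jointly Gaussian iff … — harmonic: always).  The Gaussian
part `2c_N² ≥ 0` is FREE, so
  ★ `(CFᶠ_{p,α}) BathCumulantFloor ⟹ (BKᶠ_{p,α})` (`bathKernelFloor_of_bathCumulantFloor`), EXACT modulo the two-sided momentum decorrelation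
  `(MDᶜ_{p,α}) BathMomentumDecay` (`bathCumulantFloor_of_bathKernelFloor_bathMomentumDecay`), and ★★ `(S) ∧ (CFᶠ_{0,3/2}) ⟹ 11071`
  (`boundedResponse_of_subdiffusiveBondHeat_bathCumulantFloor`).
The new top rung (CFᶠ) «the connected two-time four-point function of the bath momentum is bounded below by `−A r^{−3/2}`, `N`-uniformly» is the first
rung of the lineage that VANISHES IDENTICALLY for phonons instead of merely holding — PROVED here at the harmonic corner `lam = β = 0` of the family:
★ `K_N = 2c_N²` and `κ_N ≡ 0` for every `N ≥ 1`, `t` (`bathKinCorr_commonPast_harmonic_eq`, `bathCumulant_harmonic_eq_zero`: flow superposition + the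
Stein/Wick identities of the Gibbs measure, the same-site twin of the disprover's `HarmonicWick.harmonic_wick`), with the classical FDT `c_N(t) = T·G₀₀(t)`
(`bathMomCorr_harmonic_eq_response`, `G₀₀` = deterministic response of `p₀` to a unit kick on `p₀`), so `K_N = 2T²G₀₀² ≥ 0` (`bathKinCorr_harmonic_nonneg`):
the «square of a linear functional» is exactly the Gaussian channel `2c_N²`, and the content of (CFᶠ) is purely anharmonic.  Regimes (by hand, they decide the tags): harmonic `κ ≡ 0` (TRUE, `A = 0`); kinetic (weak anharmonicity) `κ = O(λ)` below the phonon
lifetime and the emerging diffusive energy return `≈ +r^{−3/2}` beyond it; chaotic/diffusive `c_N(r)² ≪ K_N(r)` (the momentum of a pinned chain has no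
hydrodynamic projection — `Θ`-odd, Mazur) so `κ_N ≈ K_N ≈ +r^{−3/2}`: TRUE-leaning everywhere with the SIGN as room, never needing the Gaussian
mechanism.  (MDᶜ_{0,3/2}) is phonon-FALSE (coherent ECHOES: `|c_N| ≳ N^{−1/2}` at `r ≈ 2N/v_g`, an Airy caustic even `N^{−1/3}`) and
diffusive-TRUE-leaning, so (CFᶠ) and (BKᶠ) are the SAME problem exactly where the Gaussian channel is dead and (CFᶠ) is trivial where it is alive.
INSTRUMENTABLE NOW: `κ_N(r) = K_N(r) − 2c_N(r)²` needs only the autocorrelations of `p₀` and `p₀²` along ONE equilibrium trajectory (census row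
WICK-108: the GKTAIL-105 `p₀` series at REC/P4, `N = 32…128`; harmonic control `κ ≡ 0` is a sharp null test of the estimator).

§8b THE TWO CHANNELS OF THE CUMULANT (forecast level; the same-site twin of `PhononMeanFreePathDefs.cumulant_split`, which splits the END-TO-END kernel
`C_N − 2r_N² = B_N + (P_N − 2r_N²)`).  With the boundary momentum FORECAST `m_t(z) := (P_t p₀)(z) = E_z[p₀(t)]`, the energy forecast
`G_t(z) := (P_t p₀²)(z)` and the CONDITIONAL VARIANCE `V_t(z) := G_t(z) − m_t(z)² = Var_z(p₀(t)) ≥ 0` (`momFcast_sq_le_kinFcast`, kernel Jensen):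
  ★ `K_N(t) = CP_N(t) + VC_N(t)` EXACTLY (`bathKinCorr_eq_commonPast_add_varChannel`, `N ≥ 1`, every `t`), `CP_N(t) := E_{μ_T}[(p₀²−T)·m_t²]`
  (`bathCommonPast`, COMMON-PAST channel: initial boundary heat ↔ squared momentum forecast) and `VC_N(t) := E_{μ_T}[(p₀²−T)·V_t]` (`bathVarChannel`,
  VARIANCE channel: initial boundary heat ↔ forecast kinetic TEMPERATURE of the boundary); hence
  ★ `κ_N(t) = SQ_N(t) + VC_N(t)` (`bathCumulant_eq_staticCumulant_add_varChannel`) with the STATIC forecast cumulant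
  `SQ_N(t) := CP_N(t) − 2c_N(t)² = κ₄(p₀,p₀,m_t,m_t)` under `μ_T` (`bathStaticCumulant`; `c_N(t) = ⟨p₀, m_t⟩`), and
  ★ `(SQᶠ_{p,α}) ∧ (VCᶠ_{p,α}) ⟹ (CFᶠ_{p,α})` (`bathCumulantFloor_of_staticCumulantFloor_varChannelFloor`) and, for the blocker directly (no Wick
  subtraction needed), ★ `(CPᶠ_{p,α}) ∧ (VCᶠ_{p,α}) ⟹ (BKᶠ_{p,α})` (`bathKernelFloor_of_commonPastFloor_varChannelFloor`; (CPᶠ) `BathCommonPastFloor` ⟸ (SQᶠ)).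
Harmonic calibration, PROVED (`lam = β = 0`): `m_t` is AFFINE in `z` and `V_t ≡ v(t)` is a CONSTANT (the conditional covariance of a linear SDE does
not depend on the initial state), so ★ `VC_N ≡ 0` (`bathVarChannel_harmonic_eq_zero`), `CP_N = 2c_N²` and ★ `SQ_N ≡ 0` (`bathStaticCumulant_harmonic_eq_zero`)
— both channel floors are phonon-EXACT like (CFᶠ).  Diffusive heuristics: `VC_N(t) ≈ K_N(t) ≈ +t^{−3/2}` IS the hydrodynamic
channel («a hotter bath particle now forecasts a hotter bath particle later» — the maximum-principle content of the line now sits on the conditional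
VARIANCE, not on a sign of `K_N`); `SQ_N`, `CP_N`, `c_N² → 0` fast (they are moments of the momentum forecast `m_t`, which dies with the boundary
velocity autocorrelation).  Gaussian integration by parts in the independent Gibbs coordinate `p₀` gives the attack handle
`SQ_N(t) = 2T²·Var_{μ_T}(∂_{p₀} m_t) + 2T²·E_{μ_T}[m_t ∂²_{p₀} m_t]` (paper; first/second VARIATION of the forecast in the kicked direction — a
Bismut/Malliavin object), `CP_N = 2T² E[(∂_{p₀}m_t)²] + 2T² E[m_t ∂²_{p₀}m_t]`.  ATTACK HANDLE for (VCᶠ) (paper, Γ-calculus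
of the Langevin generator, whose carré du champ is `Γ(f) = γT[(∂_{p₀}f)² + (∂_{p_{N−1}}f)²]` — noise enters only through the bath momenta): Duhamel gives
`V_t = 2γT ∫₀ᵗ P_s[S_{t−s}] ds` with the SQUARED BATH-SENSITIVITY `S_u := |∇_{bath} P_u p₀|² ≥ 0` of the momentum forecast, hence
`VC_N(t) = 2γT ∫₀ᵗ ⟨θ, P_s S_{t−s}⟩_{μ_T} ds`: (VCᶠ) is a floor on the correlation of the initial boundary heat `θ = p₀² − T` with a LATER NONNEGATIVE
functional — the shape of `K_N(t) = ⟨θ, P_t p₀²⟩` itself one rung up (`p₀² ↦ S`), and `S` is deterministic for phonons (⇒ `VC ≡ 0` again); consistency: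
`E_{μ_T} V_t = 2γT∫₀ᵗ E S_u du = T − ‖m_t‖²` is the dissipation of the forecast.  Free facts typed: `|c_N(u)| ≤ T` (`abs_bathMomCorr_le`), the law of
total variance `E_{μ_T}[V_t] = T − ‖m_t‖²_{L²(μ_T)}` (`integral_condVar_eq`), `‖m_t‖² ≤ T`.  INSTRUMENT (census row FORK-108, no nesting): two noise
replicas forked from each equilibrium microstate give `m_t(z)² = E_z[p₀^{(1)}(t)p₀^{(2)}(t)]`, hence `CP_N(t) = ⟨θ(z₀)·p₀^{(1)}(t)p₀^{(2)}(t)⟩`, `VC = K − CP`,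
`SQ = CP − 2c²` at the cost of one extra replica.

§9 CONCORDANCE with GEN 92T (`…TransientBand`, the door v2 and its §8 Warburg ladder): `escapeKernel = bathKinCorr` (`rfl`), `B_N = γT²·Ov_N`
(`bathTail_eq_mul_escapeTransient`), hence ★ `(BTᶠ_g) ⟺ (F_g)` (`bathTailFloor_iff_transientFloor`) — NODE 107's bath tail floor IS node B's transient
floor — and ★ `(BKᶠ_{0,3/2}) ⟹ WarburgDipFloor` (`warburgDipFloor_of_bathKernelFloor`: `∫(1−cos ωu)K_N ≥ −A c₂√ω − T²r₀³ω²`), so the typed (S)-side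
ladder of ONE-SIDED FLOORS now reads, every arrow PROVED and every converse open or false,
  `(SQᶠ)∧(VCᶠ) ⟹ (CFᶠ_{0,3/2}) ⟹ (BKᶠ_{0,3/2}) ⟺ (PDᶠ_{0,3/2}) ⟹ WarburgDipFloor ⟹ (F₁) ⟺ (BTᶠ_1) ⟹[(S)] 11071`
  cumulant → kernel → spectrum → tail; the Warburg dip floor (g92) is the WEAKEST typed sufficient structural piece, the cumulant floor (g108) the most
  mechanistic, and all of them hold with constant `0` for phonons.
§10 ADDENDUM — FORECASTABILITY floors the common-past channel: with `f_N(t) := ‖P_t p₀‖²_{L²(μ_T)} = T − E_{μ_T}[V_t]` (`bathFcastNorm`),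
unconditionally `CP_N(t) ≥ −T f_N(t)`, `c_N(t)² ≤ T f_N(t)`, `SQ_N(t) ≥ −3T f_N(t)`, ★ `K_N(t) ≥ VC_N(t) − T f_N(t)`; the `N`-uniform decay certificate
(FNᶜ_{p,α}) `BathForecastDecay` (phonon-FALSE, chaotic-TRUE-leaning: local scrambling of `S`-odd information, `S : (q,p) ↦ (−q,−p)`) gives (CPᶠ), (SQᶠ), (MDᶜ)
at once and ★★ `(S) ∧ (FNᶜ_{0,3/2}) ∧ (VCᶠ_{0,3/2}) ⟹ 11071`: in the chaotic regime the blocker beneath (S) is the VARIANCE CHANNEL (heat return) alone.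

TAGS.  (CFᶠ_{0,3/2}) `BathCumulantFloor 0 (3/2)`: SUFFICIENT for (BKᶠ) · INCOMPARABLE with 11071 (MustFail108) · UNDECIDED · phonon-TRUE EXACTLY (`κ ≡ 0`,
PROVED at `lam = β = 0`) ·
kinetic/diffusive-TRUE-leaning · = (BKᶠ) mod (MDᶜ) · INSTRUMENTABLE NOW (WICK-108) · IDEA-NEEDED (an `N`-uniform one-sided bound on a connected two-time
4-point function at the bath site over `r ≲ N²`: same class as the dormant `PhononMeanFreePath.IncoherentChannel` but ONE-SIDED, SAME-SITE, no limit, no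
`κ(T)`).  (MDᶜ_{0,3/2}) `BathMomentumDecay`: certificate only · phonon-FALSE (echoes) · diffusive-TRUE-leaning.  (VCᶠ) `BathVarChannelFloor`: UNDECIDED ·
phonon-TRUE EXACTLY · THE hydrodynamic channel · INSTRUMENTABLE (FORK-108) · IDEA-NEEDED (monotone coupling of the boundary kinetic temperature forecast
in the initial boundary energy).  (SQᶠ) `BathStaticCumulantFloor`: UNDECIDED · phonon-TRUE EXACTLY · chaotic-TRUE-leaning (dies with `m_t`) ·
ATTACKABLE·XL in the kinetic regime (Gaussian IBP form, second variation of the kicked flow) · INSTRUMENTABLE (FORK-108).  (CPᶠ) `BathCommonPastFloor`: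
UNDECIDED · weaker than (SQᶠ) · phonon-TRUE (`CP = 2c² ≥ 0`, PROVED at `lam = β = 0`) · with (VCᶠ) sufficient for (BKᶠ) · ATTACKABLE·L (dies with the
boundary momentum forecast: `|CP_N(t)| ≤ √2·T·‖m_t‖²_{L⁴}`, forecast-decay / `PhononMeanFreePath` budget class) · INSTRUMENTABLE (FORK-108).
No `sorry`; standard axioms; nothing here closes an item.  NOT a literature fact anywhere: every Prop is a route statement of this cell.
-/

noncomputable section

open MeasureTheory ProbabilityTheory Filter Topology Set Function
open scoped NNReal ENNReal
open Literature.MathematicalPhysics.KineticTheory.HeatConduction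
open Literature.MathematicalPhysics.KineticTheory OscillatorChain
open Literature.Probability.Process
open Summit.AtomisticToContinuum.FouriersLaw.Theorems.SubdiffusiveBondHeat
open Summit.AtomisticToContinuum.FouriersLaw.Theorems.SubdiffusiveBondHeat.EscapeGrading
open Summit.AtomisticToContinuum.FouriersLaw.Theorems.IncoherentChannel.Negative.KernelMoments
  (integrable_sq_momentum_transitionKernel harmonic_kernel_momentum harmonic_kernel_momentum_sq)
open Summit.AtomisticToContinuum.FouriersLaw.Theorems.IncoherentChannel.Negative.HarmonicFlow
  (harmonic_chainFlow_zero_noise_linear integral_gibbsMeasure_eq_zero_of_odd)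
open Summit.AtomisticToContinuum.FouriersLaw.Theorems.IncoherentChannel.Negative.GibbsStein
  (integrable_gibbsMeasure_of_growth pow_le_one_add_sq_sq gibbs_sq_momentum gibbs_momentum_mul_clm gibbs_sq_momentum_mul_clm_sq)
open Summit.AtomisticToContinuum.FouriersLaw.Cruxes.SuperadditiveResistance.FloatingProbeBypassLaplacian
  (integral_flip_gibbsMeasure integrable_flip_gibbsMeasure)

namespace Summit.AtomisticToContinuum.FouriersLaw.Theorems.BoundedResponse.HeatSpreading

open Summit.AtomisticToContinuum.FouriersLaw.Theses.BondHeatUncertainty (BoundedResponse SubdiffusiveBondHeat)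
open Summit.AtomisticToContinuum.FouriersLaw.Theorems.BoundedResponse.TransientBand
  (escapeKernel escapeTransient warburgDip TransientFloor WarburgDipFloor transientFloor_one_of_warburgDipFloor)

/-! ## §8 The Wick split `K_N = 2c_N² + κ_N` of the boundary kinetic kernel -/

/-- **Boundary MOMENTUM autocovariance** `c_N(u) := ⟨p₀, P_u p₀⟩_{μ_T} = ∫ p₀(z)·(∫ p₀ dP_u(z,·)) dμ_T(z)` (`N ≥ 1`; `0` for `N = 0`; real time clamped at
`0⁺` as in `bathKinCorr`).  `T ×` the equilibrium velocity response of the bath particle to a kick on itself; the same-site member `m_0` of the coherent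
response field of route `PhononMeanFreePath` (`PhononMeanFreePathDefs.momResp`, there on `N+1` sites). [formal bookkeeping] -/
def bathMomCorr (ω₂ lam β γ T : ℝ) (N : ℕ) (u : ℝ) : ℝ :=
  if h : 0 < N then
    ∫ z, (z.2 ⟨0, h⟩) * (∫ y, y.2 ⟨0, h⟩ ∂((pinnedChain ω₂ lam β γ).transitionKernel N T T u.toNNReal z))
      ∂((pinnedChain ω₂ lam β γ).gibbsMeasure N T)
  else 0

/-- Read-back: on `n+1` sites `c_{n+1}(u)` IS the same-site coherent response `m_0(u) = ⟨p₀, K_u p₀⟩_{μ₀}` of route `PhononMeanFreePath`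
(`PhononMeanFreePathDefs.momResp … n 0 u`, definitional). [formal bookkeeping] -/
theorem bathMomCorr_succ_eq_momResp (ω₂ lam β γ T : ℝ) (n : ℕ) (u : ℝ) :
    bathMomCorr ω₂ lam β γ T (n + 1) u = PhononMeanFreePath.momResp ω₂ lam β γ T n 0 u := by
  unfold bathMomCorr PhononMeanFreePath.momResp PhononMeanFreePath.kickResp
  rw [dif_pos (Nat.succ_pos n)]
  rfl

/-- **WICK DEFECT / two-time CUMULANT of the boundary momentum** `κ_N(u) := K_N(u) − 2·c_N(u)²` = `cum₄(p₀(0),p₀(0),p₀(u),p₀(u))` under the stationary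
path law (`E p₀ = 0`, `E p₀² = T` at both times).  `≡ 0` for the harmonic chain (Isserlis); the purely anharmonic part of `K_N`. [formal bookkeeping] -/
def bathCumulant (ω₂ lam β γ T : ℝ) (N : ℕ) (u : ℝ) : ℝ :=
  bathKinCorr ω₂ lam β γ T N u - 2 * (bathMomCorr ω₂ lam β γ T N u) ^ 2

/-- **(CFᶠ_{p,α}) `BathCumulantFloor p α`** — `N`-uniform one-sided algebraic floor on the Wick defect: `∃ A, r₀ > 0, N₀: ∀ N ≥ N₀ ∀ r ≥ r₀,
κ_N(r) ≥ −A·N^p·r^{−α}` (shape of `BathKernelFloor`).  ⟹ (BKᶠ_{p,α}) (the Gaussian part is free); at `(0,3/2)` with (S) ⟹ 11071.  Phonon-TRUE with `A = 0`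
EXACTLY (`κ ≡ 0`); kinetic/diffusive TRUE-leaning (`κ_N ≈ K_N ≈ +r^{−3/2}` past the momentum decorrelation time).  Why it might fail: a long-lived
NON-GAUSSIAN boundary excitation (anharmonic breather pinned near the bath, or the under-damped optical band edge) producing negative connected echoes
`≲ −r^{−3/2}` at `r ∼ N … N²`.  Tag: SUFFICIENT for (BKᶠ) · INCOMPARABLE with 11071 · UNDECIDED · INSTRUMENTABLE NOW · IDEA-NEEDED.
[route statement · this cell; NOT a literature fact] -/
def BathCumulantFloor (p α : ℝ) : Prop :=
  ∀ ω₂ lam β γ : ℝ, 0 < ω₂ → 0 < lam → 0 < β → 0 < γ → ∀ T : ℝ, 0 < T →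
    ∃ A r₀ : ℝ, 0 < r₀ ∧ ∃ N₀ : ℕ, ∀ N : ℕ, N₀ ≤ N → ∀ r : ℝ, r₀ ≤ r →
      -(A * (N : ℝ) ^ p * r ^ (-α)) ≤ bathCumulant ω₂ lam β γ T N r

/-- **(MDᶜ_{p,α}) `BathMomentumDecay p α`** — two-sided `N`-uniform decay of the boundary momentum autocovariance, `c_N(r)² ≤ A·N^p·r^{−α}` for `r ≥ r₀`,
`N ≥ N₀`.  ONLY a certificate: with it (BKᶠ) gives back (CFᶠ).  Phonon-FALSE at `(0,3/2)` (coherent echoes of the kicked wave packet return to the bath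
site at `r ≈ 2N/v_g` with `|c_N| ≳ N^{−1/2}`); diffusive-TRUE-leaning (no hydrodynamic projection of a momentum in a pinned chain).  Tag: certificate ·
phonon-FALSE · UNDECIDED. [route statement · this cell; NOT a literature fact] -/
def BathMomentumDecay (p α : ℝ) : Prop :=
  ∀ ω₂ lam β γ : ℝ, 0 < ω₂ → 0 < lam → 0 < β → 0 < γ → ∀ T : ℝ, 0 < T →
    ∃ A r₀ : ℝ, 0 < r₀ ∧ ∃ N₀ : ℕ, ∀ N : ℕ, N₀ ≤ N → ∀ r : ℝ, r₀ ≤ r →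
      (bathMomCorr ω₂ lam β γ T N r) ^ 2 ≤ A * (N : ℝ) ^ p * r ^ (-α)

/-- ★ **The Wick split** `K_N(u) = 2·c_N(u)² + κ_N(u)` (definitional). [formal bookkeeping] -/
theorem bathKinCorr_eq_wick_add_cumulant (ω₂ lam β γ T : ℝ) (N : ℕ) (u : ℝ) :
    bathKinCorr ω₂ lam β γ T N u = 2 * (bathMomCorr ω₂ lam β γ T N u) ^ 2 + bathCumulant ω₂ lam β γ T N u := by
  unfold bathCumulant; ring

/-- The Gaussian part is free: `κ_N ≤ K_N`. [formal bookkeeping] -/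
theorem bathCumulant_le_bathKinCorr (ω₂ lam β γ T : ℝ) (N : ℕ) (u : ℝ) :
    bathCumulant ω₂ lam β γ T N u ≤ bathKinCorr ω₂ lam β γ T N u := by
  unfold bathCumulant; nlinarith [sq_nonneg (bathMomCorr ω₂ lam β γ T N u)]

/-- ★ **(CFᶠ_{p,α}) ⟹ (BKᶠ_{p,α})**: a floor on the cumulant is a floor on the kernel (`2c_N² ≥ 0`). [this cell] -/
theorem bathKernelFloor_of_bathCumulantFloor {p α : ℝ} (hC : BathCumulantFloor p α) : BathKernelFloor p α := by
  intro ω₂ lam β γ hω hl hβ hγ T hT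
  obtain ⟨A, r₀, hr₀, N₀, hA⟩ := hC ω₂ lam β γ hω hl hβ hγ T hT
  exact ⟨A, r₀, hr₀, N₀, fun N hN r hr => (hA N hN r hr).trans (bathCumulant_le_bathKinCorr ω₂ lam β γ T N r)⟩

/-- **EXACTNESS mod (MDᶜ)**: (BKᶠ_{p,α}) ∧ (MDᶜ_{p,α}) ⟹ (CFᶠ_{p,α}) (constants `A + 2A'`). [this cell] -/
theorem bathCumulantFloor_of_bathKernelFloor_bathMomentumDecay {p α : ℝ} (hK : BathKernelFloor p α) (hM : BathMomentumDecay p α) :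
    BathCumulantFloor p α := by
  intro ω₂ lam β γ hω hl hβ hγ T hT
  obtain ⟨A, r₀, hr₀, N₀, hA⟩ := hK ω₂ lam β γ hω hl hβ hγ T hT
  obtain ⟨A', r₀', hr₀', N₀', hA'⟩ := hM ω₂ lam β γ hω hl hβ hγ T hT
  refine ⟨A + 2 * A', max r₀ r₀', lt_max_of_lt_left hr₀, max N₀ N₀', fun N hN r hr => ?_⟩
  have h1 := hA N (le_trans (le_max_left _ _) hN) r (le_trans (le_max_left _ _) hr)
  have h2 := hA' N (le_trans (le_max_right _ _) hN) r (le_trans (le_max_right _ _) hr)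
  unfold bathCumulant
  nlinarith

/-- ★★ **The cumulant door beneath the blocker: `(S) ∧ (CFᶠ_{0,3/2}) ⟹ 11071`.** [this cell] -/
theorem boundedResponse_of_subdiffusiveBondHeat_bathCumulantFloor (hS : SubdiffusiveBondHeat) (hC : BathCumulantFloor 0 (3 / 2)) :
    BoundedResponse :=
  boundedResponse_of_subdiffusiveBondHeat_bathKernelFloor hS (bathKernelFloor_of_bathCumulantFloor hC)

/-- (CFᶠ_{0,3/2}) ⟹ (BTᶠ_1). [formal bookkeeping] -/
theorem bathTailFloor_one_of_bathCumulantFloor (hC : BathCumulantFloor 0 (3 / 2)) : BathTailFloor 1 :=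
  bathTailFloor_one_of_bathKernelFloor (bathKernelFloor_of_bathCumulantFloor hC)

/-- GRADED (lens-1): (CFᶠ_{p,α}) ⟹ (BTᶠ_{max(p,0)+4−2α}) for `1 < α < 2` (through `bathTailFloor_of_bathKernelFloor`). [formal bookkeeping] -/
theorem bathTailFloor_of_bathCumulantFloor {p α : ℝ} (hα₁ : 1 < α) (hα₂ : α < 2) (hC : BathCumulantFloor p α) :
    BathTailFloor (max p 0 + 4 - 2 * α) :=
  bathTailFloor_of_bathKernelFloor hα₁ hα₂ (bathKernelFloor_of_bathCumulantFloor hC)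

/-- (CFᶠ_{p,α}) ⟹ (PDᶠ_{p,α}) (parity dominance of the energy forecast, g107 §7). [formal bookkeeping] -/
theorem bathParityDominance_of_bathCumulantFloor {p α : ℝ} (hC : BathCumulantFloor p α) : BathParityDominance p α :=
  bathKernelFloor_iff_bathParityDominance.1 (bathKernelFloor_of_bathCumulantFloor hC)

/-! ## §8b The two channels of the cumulant: common past and conditional variance -/

/-- **COMMON-PAST channel** `CP_N(t) := ∫ (p₀² − T)·m_t² dμ_T`, `m_t(z) = ∫ p₀ dP_t(z,·)` the boundary MOMENTUM FORECAST (`N ≥ 1`; `0` for `N = 0`).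
`= Cov_{μ_T}(p₀², m_t²)` (`E[p₀²] = T`); contains the Wick term `2c_N(t)²`.  [formal bookkeeping] -/
def bathCommonPast (ω₂ lam β γ T : ℝ) (N : ℕ) (t : ℝ) : ℝ :=
  if h : 0 < N then
    ∫ z, ((z.2 ⟨0, h⟩) ^ 2 - T) * (∫ y, y.2 ⟨0, h⟩ ∂((pinnedChain ω₂ lam β γ).transitionKernel N T T t.toNNReal z)) ^ 2
      ∂((pinnedChain ω₂ lam β γ).gibbsMeasure N T)
  else 0

/-- **VARIANCE channel** `VC_N(t) := ∫ (p₀² − T)·V_t dμ_T`, `V_t(z) = (∫ p₀² dP_t(z,·)) − m_t(z)² = Var_z(p₀(t))` the CONDITIONAL VARIANCE of the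
boundary momentum forecast (`N ≥ 1`; `0` for `N = 0`).  `= Cov_{μ_T}(p₀(0)², Var_z p₀(t))`: initial boundary heat against the forecast kinetic
TEMPERATURE of the boundary.  The same-site twin of `PhononMeanFreePathDefs.varianceChannel`. [formal bookkeeping] -/
def bathVarChannel (ω₂ lam β γ T : ℝ) (N : ℕ) (t : ℝ) : ℝ :=
  if h : 0 < N then
    ∫ z, ((z.2 ⟨0, h⟩) ^ 2 - T) *
        ((∫ y, (y.2 ⟨0, h⟩) ^ 2 ∂((pinnedChain ω₂ lam β γ).transitionKernel N T T t.toNNReal z)) -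
          (∫ y, y.2 ⟨0, h⟩ ∂((pinnedChain ω₂ lam β γ).transitionKernel N T T t.toNNReal z)) ^ 2)
      ∂((pinnedChain ω₂ lam β γ).gibbsMeasure N T)
  else 0

/-- **STATIC forecast cumulant** `SQ_N(t) := CP_N(t) − 2c_N(t)² = κ₄(p₀,p₀,m_t,m_t)` — the joint fourth cumulant, under the one-time Gibbs law `μ_T`,
of the Gaussian coordinate `p₀` and the (nonlinear) forecast functional `m_t` (`c_N(t) = ⟨p₀, m_t⟩`).  `≡ 0` when `m_t` is linear (phonons).
[formal bookkeeping] -/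
def bathStaticCumulant (ω₂ lam β γ T : ℝ) (N : ℕ) (t : ℝ) : ℝ :=
  bathCommonPast ω₂ lam β γ T N t - 2 * (bathMomCorr ω₂ lam β γ T N t) ^ 2

/-- **(VCᶠ_{p,α}) `BathVarChannelFloor p α`** — `∃ A, t₀ > 0, N₀: ∀ N ≥ N₀ ∀ t ≥ t₀, VC_N(t) ≥ −A·N^p·t^{−α}`: the initial boundary heat never
forecasts a COLDER-than-average boundary later by more than `A t^{−α}`.  Phonon-TRUE EXACTLY (`V_t` constant ⇒ `VC ≡ 0`); diffusive: `VC_N ≈ +t^{−3/2}`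
IS the hydrodynamic return channel.  Why it might fail: phase-space shear of a strongly anharmonic pinning well makes `Var_z p₀(t)` DEcreasing in the
initial energy at intermediate times (focusing), and a slow boundary mode could carry that anti-correlation to `t ∼ N`.  Tag: UNDECIDED · phonon-TRUE ·
INSTRUMENTABLE (FORK-108) · IDEA-NEEDED. [route statement · this cell; NOT a literature fact] -/
def BathVarChannelFloor (p α : ℝ) : Prop :=
  ∀ ω₂ lam β γ : ℝ, 0 < ω₂ → 0 < lam → 0 < β → 0 < γ → ∀ T : ℝ, 0 < T →
    ∃ A t₀ : ℝ, 0 < t₀ ∧ ∃ N₀ : ℕ, ∀ N : ℕ, N₀ ≤ N → ∀ t : ℝ, t₀ ≤ t →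
      -(A * (N : ℝ) ^ p * t ^ (-α)) ≤ bathVarChannel ω₂ lam β γ T N t

/-- **(SQᶠ_{p,α}) `BathStaticCumulantFloor p α`** — `∃ A, t₀ > 0, N₀: ∀ N ≥ N₀ ∀ t ≥ t₀, SQ_N(t) ≥ −A·N^p·t^{−α}`: the forecast `m_t` is
«not too platykurtic against `p₀`».  Phonon-TRUE EXACTLY (`m_t` linear); chaotic-TRUE-leaning (`|SQ_N| ≲ E m_t⁴ → 0` with the boundary velocity
autocorrelation); Gaussian IBP form `SQ_N = 2T² Var(∂_{p₀}m_t) + 2T² E[m_t ∂²_{p₀}m_t]` (paper).  Why it might fail: a resonant kick response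
(`∂²_{p₀}m_t` large and anti-aligned with `m_t`) at the optical band edge surviving to `t ∼ N`.  Tag: UNDECIDED · phonon-TRUE · ATTACKABLE·XL (kinetic
regime) · INSTRUMENTABLE (FORK-108). [route statement · this cell; NOT a literature fact] -/
def BathStaticCumulantFloor (p α : ℝ) : Prop :=
  ∀ ω₂ lam β γ : ℝ, 0 < ω₂ → 0 < lam → 0 < β → 0 < γ → ∀ T : ℝ, 0 < T →
    ∃ A t₀ : ℝ, 0 < t₀ ∧ ∃ N₀ : ℕ, ∀ N : ℕ, N₀ ≤ N → ∀ t : ℝ, t₀ ≤ t →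
      -(A * (N : ℝ) ^ p * t ^ (-α)) ≤ bathStaticCumulant ω₂ lam β γ T N t

/-- **(CPᶠ_{p,α}) `BathCommonPastFloor p α`** — `∃ A, t₀ > 0, N₀: ∀ N ≥ N₀ ∀ t ≥ t₀, CP_N(t) ≥ −A·N^p·t^{−α}`: the initial boundary heat does not
ANTI-correlate with the squared momentum forecast `m_t²` beyond `A t^{−α}`.  WEAKER than (SQᶠ) (`CP = SQ + 2c² ≥ SQ`, `bathCommonPastFloor_of_staticCumulantFloor`)
and, with (VCᶠ), ALREADY sufficient for the kernel floor (`K = CP + VC`: `bathKernelFloor_of_commonPastFloor_varChannelFloor`) — the Wick subtraction is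
needed for (CFᶠ), not for the blocker.  Phonon-TRUE with `A = 0` (`CP = 2c_N² ≥ 0`, PROVED at `lam = β = 0`: `bathCommonPast_harmonic_nonneg`);
chaotic-TRUE-leaning (`|CP_N(t)| ≤ √2·T·‖m_t‖²_{L⁴(μ_T)}` dies with the boundary momentum forecast — a ONE-observable forecast-decay statement of the
`PhononMeanFreePath` budget class would give even the two-sided version).  Why it might fail: as (SQᶠ).  Tag: UNDECIDED · phonon-TRUE · weaker than (SQᶠ) ·
INSTRUMENTABLE (FORK-108) · ATTACKABLE·L (forecast-decay class). [route statement · this cell; NOT a literature fact] -/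
def BathCommonPastFloor (p α : ℝ) : Prop :=
  ∀ ω₂ lam β γ : ℝ, 0 < ω₂ → 0 < lam → 0 < β → 0 < γ → ∀ T : ℝ, 0 < T →
    ∃ A t₀ : ℝ, 0 < t₀ ∧ ∃ N₀ : ℕ, ∀ N : ℕ, N₀ ≤ N → ∀ t : ℝ, t₀ ≤ t →
      -(A * (N : ℝ) ^ p * t ^ (-α)) ≤ bathCommonPast ω₂ lam β γ T N t

/-- `SQ_N ≤ CP_N` (the Wick term `2c_N²` is nonnegative). [formal bookkeeping] -/
theorem bathStaticCumulant_le_bathCommonPast (ω₂ lam β γ T : ℝ) (N : ℕ) (t : ℝ) :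
    bathStaticCumulant ω₂ lam β γ T N t ≤ bathCommonPast ω₂ lam β γ T N t := by
  unfold bathStaticCumulant; nlinarith [sq_nonneg (bathMomCorr ω₂ lam β γ T N t)]

/-- (SQᶠ_{p,α}) ⟹ (CPᶠ_{p,α}). [formal bookkeeping] -/
theorem bathCommonPastFloor_of_staticCumulantFloor {p α : ℝ} (hS : BathStaticCumulantFloor p α) : BathCommonPastFloor p α := by
  intro ω₂ lam β γ hω hl hβ hγ T hT
  obtain ⟨A, t₀, ht₀, N₀, hA⟩ := hS ω₂ lam β γ hω hl hβ hγ T hT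
  exact ⟨A, t₀, ht₀, N₀, fun N hN t ht => (hA N hN t ht).trans (bathStaticCumulant_le_bathCommonPast ω₂ lam β γ T N t)⟩

end Summit.AtomisticToContinuum.FouriersLaw.Theorems.BoundedResponse.HeatSpreading
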